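import Summits.QuantumFields.YangMills.Theorems.FluctuationComparisonRegPrIntLS2BetaWhitneyHatLift
import Summits.QuantumFields.YangMills.Theorems.FluctuationComparisonRegPrIntLS2BetaWhitneyHatCurl
import Summits.QuantumFields.YangMills.Theorems.FluctuationComparisonRegPrIntLS2BetaSU2FourFactorExpansion
import HarnessLib

/-!
# S2β · `hFlat` road, brick (ii-c) of UV3-NODE §57.8 — THE CURVATURE LETTER OF THE GEODESIC WHITNEY HAT LIFT:
# `dist1 (V(∂p)) ≤ L⁻² · (F + 12 s²) + 12 · (L⁻¹ s)²` — the `L⁻²` gain on the coarse flux `F` plus the non-abelian SIZE × SIZE term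

Cell `ym3-torus` (rung R3 = continuum `SU(2)` Yang–Mills on the three-torus — NOT d = 4, NOT infinite volume, NOT a mass gap, NOT Clay).
Width seat «width 12» `ym3-torus-px12` (gen 23), FREE px helper on crux `stmt-QuantumFields-20520` (`Theses.UnitScaleTilt.FluctuationComparisonRegPrIntL`),
count-neutral, DEFINITION-FREE (the lift `V` and its weights `w` pinned by the displayed formulas `hV`, `hw` of ✓`…S2BetaWhitneyHatLift`).

WHAT (R2) CONSUMES (UV3-NODE §57.8 (B); px13 g22's (ii-b) `…RelativeFieldLetter` §3∕§4: the relative interior∕face letters are sums over `≤ L² − 1` fine plaquettes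
`q` of `dist1 (rect W q …) + dist1 (rect U₀ q …)` with the background `U₀ :=` the lift `V`).  THIS FILE bounds each fine plaquette of the background, LOCALLY: if
`σ ≤ 1∕4` bounds the arcs of the coarse bonds that FEED the four bonds of the fine plaquette `p` (`w b e ≠ 0`, ✓`….hatW_support`) and the edges of the coarse plaquettes
of the cube column through `p` (column weight `W(p, y) ≠ 0`, ✓`…S2BetaWhitneyHatCurl.colW_support`), and `F` bounds the arcs of those coarse plaquettes:
    ★★★ `dist1_plaqHol_lift_le : dist1 (plaqHol V p) ≤ (L⁻¹)² · (F + 12 σ²) + 12 · (L⁻¹ σ)²`  (`dist1_plaqHol_lift_le_of_forall`: global `s`, `≤ (L⁻¹)² · (F + 24 s²)`).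
So `L²` fine plaquettes of the flap cost `F + 24 σ²`: FLUX (chargeable to `R_t`) + LOCAL SIZE² — in `ℓ²` over a level `O(s_t) ×` the coarse field's `ℓ²`-size, i.e. the
summable defect `ε_t` of ✓p814904 `recursion_varRatio_sqrtL_le` (factor `exp E`), NOT an absolute `s²` per bond (which would be volume-divergent).  The located non-abelian
defect itself (the hat lift of a flat non-abelian field is not flat): px12 g23 07:12:49Z, px8 g21 07:14:09Z (2) CONFIRMED, px20 g19 CONCUR.
PROOF = ✓`…S2BetaSU2FourFactorExpansion.dist1_plaq4_le` (fine word to first order, `τ = L⁻¹ s`) + ✓`…S2BetaWhitneyHatCurl.norm_lincurl_hat_le` (the discrete Whitney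
identity: fine linearised curl `= L⁻¹ ×` column mean of coarse linearised curls) + ✓`….norm_lincurl_logVec_le_arc_add` (coarse linearised curl `≤ arc + 12 s²`).

HONEST SCOPE.  Bookkeeping over the three companions; nothing of Bałaban's analysis is asserted ([Balaban1985RegularSpaces] (1.29) p.81 is the printed locus of the geodesic
interpolation; [Balaban1985Variational] (34) p.283 of the plaquette expansion); (R2), the recursion's premises, `hFlat`, TUBE-REG∘, GAP♯∘ (`stub_uniformFibreGapOrbit`), S2β,
crux 20520 and `YM3TorusSU2` are NOT proved; no registered stub is closed; the Yang–Mills mass gap is NOT proved.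
References: T. Bałaban, CMP **99** (1985) 75–102 [Balaban1985RegularSpaces] ((1.29) p.81); CMP **102** (1985) 277–309 [Balaban1985Variational] ((34) p.283).
-/

set_option autoImplicit false

noncomputable section

namespace Summit.QuantumFields.YangMills.Theorems.FluctuationComparisonRegPrIntLS2BetaWhitneyHatLiftCurvature

open Finset
open scoped Real
open Literature.MathematicalPhysics.QuantumLattice (su2Quat)
open Literature.MathematicalPhysics.QuantumFieldTheory.Balaban1983to89
open B10Eq27TorusAxialLog (rel rel_apply)
open T4CubeChartGnomonic (SU2)
open T4HaarSU2ExpChart (expPoint)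
open T4ExpWindowSmallField (logVec)
open Summit.QuantumFields.YangMills.Theorems.FluctuationComparisonRegPrIntLS2BetaWhitneyHatLift (arc_lift_le)
open Summit.QuantumFields.YangMills.Theorems.FluctuationComparisonRegPrIntLS2BetaWhitneyHatCurl (norm_lincurl_hat_le colW_support)
open Summit.QuantumFields.YangMills.Theorems.FluctuationComparisonRegPrIntLS2BetaSU2FourFactorExpansion
  (dist1_plaq4_le norm_lincurl_logVec_le_arc_add)

variable {P : Params} {t : ℕ}

/-- A convex combination over the hat weights of vectors that are `≤ r` ON THE SUPPORT of the weights is `≤ r`. [folklore] -/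
theorem norm_hatSum_le_of_support (ht : t + 1 ≤ P.m + P.K) (w : PBond P t → PBond P (t + 1) → ℝ)
    (hw : ∀ b e, w b e = if e.dir = b.dir ∧ (b.src b.dir - emb e.src b.dir).val < P.L then
      ∏ ν ∈ Finset.univ.erase b.dir, max 0 (1 - ((rel (emb e.src) b.src ν).natAbs : ℝ) / P.L) else 0)
    (A : PBond P (t + 1) → EuclideanSpace ℝ (Fin 3)) (b : PBond P t) {r : ℝ} (hr : ∀ e, w b e ≠ 0 → ‖A e‖ ≤ r) :
    ‖∑ e, w b e • A e‖ ≤ r := by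
  classical
  set S : Finset (PBond P (t + 1)) := Finset.univ.filter fun e => w b e ≠ 0 with hS
  have hsub : ∑ e ∈ S, w b e • A e = ∑ e, w b e • A e := by
    refine Finset.sum_subset (Finset.subset_univ S) fun e _ he => ?_
    have : w b e = 0 := by simpa [hS] using he
    rw [this, zero_smul]
  have hone : ∑ e ∈ S, w b e = 1 := by
    rw [← FluctuationComparisonRegPrIntLS2BetaWhitneyHatWeights.sum_hatW_eq_one ht w hw b]
    refine Finset.sum_subset (Finset.subset_univ S) fun e _ he => ?_
    simpa [hS] using he
  rw [← hsub]
  exact FluctuationComparisonRegPrIntLS2BetaGeodesicJensenLift.norm_sum_smul_le_of_forall_le S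
    (fun e _ => FluctuationComparisonRegPrIntLS2BetaWhitneyHatWeights.hatW_nonneg w hw b e) hone fun e he => hr e (by simpa [hS] using he)

/-- ★★★ **THE CURVATURE OF THE HAT LIFT, PLAQUETTE BY PLAQUETTE, LOCAL FORM**: let `σ ≤ 1∕4` bound the arcs of the coarse bonds that FEED the four bonds of the fine
plaquette `p` (`w b e ≠ 0`) and of the edges of the coarse plaquettes of the cube column through `p` (`W(p, y) ≠ 0`), and let `F` bound the arcs of those coarse
plaquettes; then `dist1 (V(∂p)) ≤ (L⁻¹)² · (F + 12 σ²) + 12 · (L⁻¹ σ)²` — the `L⁻²` gain on the FLUX plus the non-abelian SIZE × SIZE term in the LOCAL sizes (so that in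
`ℓ²` over a level it is `O(s_t) ×` the coarse field's `ℓ²`-size, the summable defect `ε_t` of ✓p814904 §5 — NOT an absolute `s²` per bond). [cite: Balaban1985RegularSpaces, (1.29) p.81] -/
theorem dist1_plaqHol_lift_le (ht : t + 1 ≤ P.m + P.K) (w : PBond P t → PBond P (t + 1) → ℝ)
    (hw : ∀ b e, w b e = if e.dir = b.dir ∧ (b.src b.dir - emb e.src b.dir).val < P.L then
      ∏ ν ∈ Finset.univ.erase b.dir, max 0 (1 - ((rel (emb e.src) b.src ν).natAbs : ℝ) / P.L) else 0)
    (X : GaugeField P (t + 1) SU2) (V : GaugeField P t SU2)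
    (hV : ∀ b, V b = expPoint (∑ e, w b e • ((P.L : ℝ)⁻¹ • logVec (su2Quat (X e))))) (p : Plaq P t) {σ F : ℝ} (hσ4 : σ ≤ 1 / 4)
    (hσb : ∀ e, (w ⟨p.src, p.μ⟩ e ≠ 0 ∨ w ⟨p.src.shift p.μ, p.ν⟩ e ≠ 0 ∨ w ⟨p.src.shift p.ν, p.μ⟩ e ≠ 0 ∨ w ⟨p.src, p.ν⟩ e ≠ 0) →
      ‖logVec (su2Quat (X e))‖ ≤ σ)
    (hσy : ∀ y : Site P (t + 1), (if (p.src p.μ - emb y p.μ).val < P.L then (1 : ℝ) else 0) *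
          (∏ κ ∈ (Finset.univ.erase p.μ).erase p.ν, max 0 (1 - ((rel (emb y) p.src κ).natAbs : ℝ) / P.L)) *
          (if (p.src p.ν - emb y p.ν).val < P.L then (1 : ℝ) else 0) ≠ 0 →
      ‖logVec (su2Quat (X ⟨y, p.μ⟩))‖ ≤ σ ∧ ‖logVec (su2Quat (X ⟨y.shift p.μ, p.ν⟩))‖ ≤ σ ∧
        ‖logVec (su2Quat (X ⟨y.shift p.ν, p.μ⟩))‖ ≤ σ ∧ ‖logVec (su2Quat (X ⟨y, p.ν⟩))‖ ≤ σ ∧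
        ‖logVec (su2Quat (GaugeField.plaqHol X ⟨y, p.μ, p.ν, p.hμν⟩))‖ ≤ F) :
    dist1 (GaugeField.plaqHol V p) ≤ ((P.L : ℝ)⁻¹) ^ 2 * (F + 12 * σ ^ 2) + 12 * ((P.L : ℝ)⁻¹ * σ) ^ 2 := by
  have hL1 : (1 : ℝ) ≤ P.L := by exact_mod_cast P.L_pos
  have hLinv : (P.L : ℝ)⁻¹ ≤ 1 := inv_le_one_of_one_le₀ hL1
  have hLinv0 : 0 ≤ (P.L : ℝ)⁻¹ := inv_nonneg.mpr (Nat.cast_nonneg _)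
  -- the exponents of the lift: convex combinations of `L⁻¹`-scaled coarse logarithms, hence `L⁻¹ σ`-small on the four bonds of `p`
  set A : PBond P (t + 1) → EuclideanSpace ℝ (Fin 3) := fun e => (P.L : ℝ)⁻¹ • logVec (su2Quat (X e)) with hA
  set a : PBond P t → EuclideanSpace ℝ (Fin 3) := fun b => ∑ e, w b e • A e with ha
  have hVa : ∀ b, V b = expPoint (a b) := fun b => by rw [hV]
  have hAσ : ∀ e, ‖logVec (su2Quat (X e))‖ ≤ σ → ‖A e‖ ≤ (P.L : ℝ)⁻¹ * σ := fun e he => by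
    rw [hA]; dsimp only; rw [norm_smul, Real.norm_eq_abs, abs_of_nonneg hLinv0]
    exact mul_le_mul_of_nonneg_left he hLinv0
  have ha1 : ‖a ⟨p.src, p.μ⟩‖ ≤ (P.L : ℝ)⁻¹ * σ :=
    norm_hatSum_le_of_support ht w hw A _ fun e he => hAσ e (hσb e (Or.inl he))
  have ha2 : ‖a ⟨p.src.shift p.μ, p.ν⟩‖ ≤ (P.L : ℝ)⁻¹ * σ :=
    norm_hatSum_le_of_support ht w hw A _ fun e he => hAσ e (hσb e (Or.inr (Or.inl he)))
  have ha3 : ‖a ⟨p.src.shift p.ν, p.μ⟩‖ ≤ (P.L : ℝ)⁻¹ * σ :=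
    norm_hatSum_le_of_support ht w hw A _ fun e he => hAσ e (hσb e (Or.inr (Or.inr (Or.inl he))))
  have ha4 : ‖a ⟨p.src, p.ν⟩‖ ≤ (P.L : ℝ)⁻¹ * σ :=
    norm_hatSum_le_of_support ht w hw A _ fun e he => hAσ e (hσb e (Or.inr (Or.inr (Or.inr he))))
  have hLpos : 0 < (P.L : ℝ)⁻¹ := inv_pos.mpr (by exact_mod_cast P.L_pos)
  have hσ0 : 0 ≤ σ := le_of_mul_le_mul_left (by rw [mul_zero]; exact (norm_nonneg _).trans ha1) hLpos
  have hτ : (P.L : ℝ)⁻¹ * σ ≤ 1 / 4 := (mul_le_of_le_one_left hσ0 hLinv).trans hσ4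
  -- the four-factor expansion of the fine plaquette
  have h1 : dist1 (GaugeField.plaqHol V p) ≤ ‖a ⟨p.src, p.μ⟩ + a ⟨p.src.shift p.μ, p.ν⟩ - a ⟨p.src.shift p.ν, p.μ⟩ - a ⟨p.src, p.ν⟩‖
      + 12 * ((P.L : ℝ)⁻¹ * σ) ^ 2 := by
    unfold GaugeField.plaqHol
    rw [hVa, hVa, hVa, hVa]
    exact dist1_plaq4_le ha1 ha2 ha3 ha4 hτ
  -- the discrete Whitney identity bounds the fine linearised curl by `L⁻¹ ×` the worst coarse one of the column
  have h2 : ‖a ⟨p.src, p.μ⟩ + a ⟨p.src.shift p.μ, p.ν⟩ - a ⟨p.src.shift p.ν, p.μ⟩ - a ⟨p.src, p.ν⟩‖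
      ≤ (P.L : ℝ)⁻¹ * ((P.L : ℝ)⁻¹ * (F + 12 * σ ^ 2)) := by
    refine norm_lincurl_hat_le ht w hw A a (fun _ => rfl) p fun y hy => ?_
    obtain ⟨g1, g2, g3, g4, gF⟩ := hσy y hy
    have h3 := norm_lincurl_logVec_le_arc_add (X ⟨y, p.μ⟩) (X ⟨y.shift p.μ, p.ν⟩) (X ⟨y.shift p.ν, p.μ⟩) (X ⟨y, p.ν⟩) g1 g2 g3 g4 hσ4
    rw [hA]; dsimp only
    rw [← smul_add, ← smul_sub, ← smul_sub, norm_smul, Real.norm_eq_abs, abs_of_nonneg hLinv0]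
    refine mul_le_mul_of_nonneg_left (h3.trans ?_) hLinv0
    exact (add_le_add_iff_right _).mpr gF
  calc dist1 (GaugeField.plaqHol V p)
      ≤ (P.L : ℝ)⁻¹ * ((P.L : ℝ)⁻¹ * (F + 12 * σ ^ 2)) + 12 * ((P.L : ℝ)⁻¹ * σ) ^ 2 := h1.trans ((add_le_add_iff_right _).mpr h2)
    _ = ((P.L : ℝ)⁻¹) ^ 2 * (F + 12 * σ ^ 2) + 12 * ((P.L : ℝ)⁻¹ * σ) ^ 2 := by ring

/-- **GLOBAL FORM** (all coarse bonds `s`-small, `s ≤ 1∕4`, all column plaquettes `≤ F`): `dist1 (V(∂p)) ≤ (L⁻¹)² · (F + 24 s²)`. [cite: Balaban1985RegularSpaces, (1.29) p.81] -/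
theorem dist1_plaqHol_lift_le_of_forall (ht : t + 1 ≤ P.m + P.K) (w : PBond P t → PBond P (t + 1) → ℝ)
    (hw : ∀ b e, w b e = if e.dir = b.dir ∧ (b.src b.dir - emb e.src b.dir).val < P.L then
      ∏ ν ∈ Finset.univ.erase b.dir, max 0 (1 - ((rel (emb e.src) b.src ν).natAbs : ℝ) / P.L) else 0)
    (X : GaugeField P (t + 1) SU2) (V : GaugeField P t SU2)
    (hV : ∀ b, V b = expPoint (∑ e, w b e • ((P.L : ℝ)⁻¹ • logVec (su2Quat (X e)))))
    {s : ℝ} (hs : ∀ e, ‖logVec (su2Quat (X e))‖ ≤ s) (hs4 : s ≤ 1 / 4) (p : Plaq P t) {F : ℝ}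
    (hF : ∀ y : Site P (t + 1), (if (p.src p.μ - emb y p.μ).val < P.L then (1 : ℝ) else 0) *
          (∏ κ ∈ (Finset.univ.erase p.μ).erase p.ν, max 0 (1 - ((rel (emb y) p.src κ).natAbs : ℝ) / P.L)) *
          (if (p.src p.ν - emb y p.ν).val < P.L then (1 : ℝ) else 0) ≠ 0 →
      ‖logVec (su2Quat (GaugeField.plaqHol X ⟨y, p.μ, p.ν, p.hμν⟩))‖ ≤ F) :
    dist1 (GaugeField.plaqHol V p) ≤ ((P.L : ℝ)⁻¹) ^ 2 * (F + 24 * s ^ 2) := by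
  have h := dist1_plaqHol_lift_le ht w hw X V hV p hs4 (fun e _ => hs e) fun y hy => ⟨hs _, hs _, hs _, hs _, hF y hy⟩
  have e : ((P.L : ℝ)⁻¹) ^ 2 * (F + 12 * s ^ 2) + 12 * ((P.L : ℝ)⁻¹ * s) ^ 2 = ((P.L : ℝ)⁻¹) ^ 2 * (F + 24 * s ^ 2) := by ring
  rwa [e] at h

end Summit.QuantumFields.YangMills.Theorems.FluctuationComparisonRegPrIntLS2BetaWhitneyHatLiftCurvature

end
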